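import Mathlib.Analysis.Analytic.Constructions
import Mathlib.Analysis.Analytic.Linear
import Mathlib.Topology.ContinuousMap.Bounded.Normed
import Mathlib.Topology.Order.Compact
import Literature.Probability.RandomPlanarGeometry.ShearModulusAnalyticDatum
import Literature.Probability.RandomPlanarGeometry.ImageUnivalent
import Literature.Probability.RandomPlanarGeometry.ShearModulusAnalytic
import HarnessLib

/-!
# The modulus of a sheared quadrilateral is real-analytic in the shear, GIVEN Ahlfors–Bers

Topic `Literature/Probability/RandomPlanarGeometry`; third of the three files
(`ShearModulusAnalyticBeltrami`, `ShearModulusAnalyticDatum`, `ShearModulusAnalyticProofs`) on the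
named fact `Literature.Probability.RandomPlanarGeometry.ShearCrossRatioAnalytic`
(`ShearModulusAnalytic.lean`: for every conformal rectangle `R'` the conformal modulus of
Beffara's sheared quad `φ_α R'` is a real-analytic function of `α ∈ ℍ`). Everything here is
PROVED; no definition and no named fact is introduced.

Main result `shearCrossRatioAnalytic_of_ahlforsBers`: `ShearCrossRatioAnalytic` follows from the
**Ahlfors–Bers theorem on the analytic dependence of normalised solutions of the Beltrami
equation on parameters** (L. V. Ahlfors, L. Bers, *Riemann's mapping theorem for variable
metrics*, Ann. of Math. 72 (1960): Thm. 6 (normalised `μ`-conformal self-maps), Lemma 7 with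
Thm. 5 (vii) (`C¹` regularity, positive Jacobian), Thm. 11 and its Corollary p. 404 (analytic
dependence on real parameters)), taken as the HYPOTHESIS `hAB` in its half-plane form with the
parameter ranging over open subsets of `ℂ`: for a coefficient family `μ t`, `C¹` on `ℍₒ`,
`‖μ t‖ ≤ k < 1`, real-analytic in `t` as a map into the bounded continuous functions on `ℍₒ`,
there are self-homeomorphisms `W t` (inverses `V t`) of the closed upper half-plane fixing
`0, 1, ∞`, increasing on `ℝ`, mapping `ℍₒ` onto `ℍₒ`, real-differentiable on `ℍₒ` with
`W_z̄ = μ W_z`, `W_z ≠ 0` (written through `A = fderiv ℝ (W t) z` as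
`A 1 + i A i = μ (A 1 - i A i)`, `A 1 - i A i ≠ 0`), and with `t ↦ W t z` real-analytic for
every `z`, `im z ≥ 0`. No quasiconformal theory (Beurling transform, measurable Riemann mapping
theorem) exists in Mathlib or in the tree (2026-08-16), which is why the Ahlfors–Bers theorem
enters as a hypothesis and `ShearCrossRatioAnalytic` stays a named fact; this file is its proof
modulo that one classical theorem.

Ingredients proved here: the coefficient family `μ_α = ν(α) \overline{f′'}/f′'` of `φ_α ∘ f'`
(`contDiffOn_shearCoeff`, `norm_shearCoeff`, `exists_analytic_shearCoeff`: `C¹` on `ℍₒ`, of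
modulus `|ν(α)| < 1`, and `α ↦ μ_α = ν(α) • G` real-analytic into `ℍₒ →ᵇ ℂ`), presentation
independence of the modulus (`crossRatio_eq_of_shear_presentations`, conformal invariance of the
cross-ratio), and the assembly: with `M α` the modulus of the canonical presentation
`R'.map (shearHomeomorph α)`, near each `α₀ ∈ ℍ` the Ahlfors–Bers solutions on a ball (uniform
bound `k = max ‖ν‖ < 1` on the closed ball) give the data `(φ_α ∘ f' ∘ V_α, W_α ∘ x')`
(`exists_isUniformizing_shear`), so `M α = crossRatio (W_α ∘ x')` there, a rational function with
non-vanishing denominators of the real-analytic functions `α ↦ W_α (x'_i)`.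

## References

* L. V. Ahlfors, L. Bers, *Riemann's mapping theorem for variable metrics*, Ann. of Math. (2) 72
  (1960), 385–404: Thm. 5 (vii), Lemma 7, Thm. 6, Thm. 11 and Corollary p. 404. [AhlforsBers1960]
* L. V. Ahlfors, *Lectures on Quasiconformal Mappings* (1966), Ch. V; O. Lehto, K. I. Virtanen,
  *Quasiconformal Mappings in the Plane* (1973), Ch. V §6 (secondary). [LehtoVirtanen1973]
* V. Beffara, *Is critical 2D percolation universal?*, Progr. Probab. 60 (2008), §1.1, §2.1.
  [Beffara2008Universal]
-/

noncomputable section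

open Set Filter Complex Metric
open scoped Topology ComplexConjugate BoundedContinuousFunction
open UpperHalfPlane (upperHalfPlaneSet isOpen_upperHalfPlaneSet)

namespace Literature.Probability.RandomPlanarGeometry

open Literature.Barriers.CriticalPhenomena (moduliShear moduliShear_eq_hol_add_antihol
  shearHomeomorph coe_shearHomeomorph continuous_moduliShear)

/-! ### The coefficient family `μ_α = ν(α) · \overline{f′'}/f′'` -/

section Coefficient

variable {U : Set ℂ} (f' : ConformalEquiv upperHalfPlaneSet U)

/-- `\overline{f′'}/f′'` is continuously real-differentiable on `ℍₒ` (`f′'` is holomorphic and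
non-vanishing there), hence so is `ν · \overline{f′'}/f′'`. [folklore] -/
theorem contDiffOn_shearCoeff (ν : ℂ) :
    ContDiffOn ℝ 1 (fun z => ν * (conj (deriv f' z) / deriv f' z)) upperHalfPlaneSet := by
  have hC : ContDiffOn ℂ 1 (deriv f') upperHalfPlaneSet :=
    (f'.differentiableOn.deriv isOpen_upperHalfPlaneSet).contDiffOn isOpen_upperHalfPlaneSet
  have hR : ContDiffOn ℝ 1 (deriv f') upperHalfPlaneSet := hC.restrict_scalars ℝ
  have hconj : ContDiffOn ℝ 1 (fun z => conj (deriv f' z)) upperHalfPlaneSet :=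
    Complex.conjCLE.contDiff.comp_contDiffOn hR
  have hinv : ContDiffOn ℝ 1 (fun z => (deriv f' z)⁻¹) upperHalfPlaneSet :=
    hR.inv fun z hz => ConformalEquiv.deriv_ne_zero_holds f' isOpen_upperHalfPlaneSet hz
  have h := (contDiffOn_const (c := ν)).mul (hconj.mul hinv)
  simpa only [div_eq_mul_inv] using h

/-- `|ν · \overline{f′'}/f′'| = |ν|` on `ℍₒ`. [folklore] -/
theorem norm_shearCoeff (ν : ℂ) {z : ℂ} (hz : z ∈ upperHalfPlaneSet) :
    ‖ν * (conj (deriv f' z) / deriv f' z)‖ = ‖ν‖ := by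
  have h := ConformalEquiv.deriv_ne_zero_holds f' isOpen_upperHalfPlaneSet hz
  rw [norm_mul, norm_div, Complex.norm_conj, div_self (norm_ne_zero_iff.2 h), mul_one]

/-- **The coefficient family is real-analytic in the shear as a bounded-function-valued map**:
`α ↦ ν(α) · \overline{f′'}/f′' = ν(α) • G` with `G ∈ (ℍₒ →ᵇ ℂ)` fixed and
`ν(α) = (1 + iα)/(1 - iα)` holomorphic off `α = -i`. [folklore] -/
theorem exists_analytic_shearCoeff :
    ∃ μ' : ℂ → (upperHalfPlaneSet →ᵇ ℂ), AnalyticOnNhd ℝ μ' upperHalfPlaneSet ∧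
      ∀ t ∈ upperHalfPlaneSet, ∀ (z : ℂ) (hz : z ∈ upperHalfPlaneSet),
        μ' t ⟨z, hz⟩ = (1 + I * t) / (1 - I * t) * (conj (deriv f' z) / deriv f' z) := by
  set g : upperHalfPlaneSet → ℂ := fun z => conj (deriv f' z) / deriv f' z with hg
  have hg_cont : Continuous g := by
    have h := ((contDiffOn_shearCoeff f' 1).continuousOn).restrict
    refine h.congr fun z => ?_
    simp [hg]
  have hg_bd : ∀ z, ‖g z‖ ≤ 1 := by
    intro z
    have h := norm_shearCoeff f' 1 z.2
    rw [one_mul, norm_one] at h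
    exact h.le
  set G : upperHalfPlaneSet →ᵇ ℂ := BoundedContinuousFunction.ofNormedAddCommGroup g hg_cont 1 hg_bd
    with hG
  refine ⟨fun t => ((1 + I * t) / (1 - I * t)) • G, fun t ht => ?_, fun t _ z hz => ?_⟩
  · have hν : AnalyticAt ℂ (fun t : ℂ => (1 + I * t) / (1 - I * t)) t := by
      have h1 : AnalyticAt ℂ (fun t : ℂ => 1 + I * t) t := by fun_prop
      have h2 : AnalyticAt ℂ (fun t : ℂ => 1 - I * t) t := by fun_prop
      exact h1.div h2 (one_sub_I_mul_ne_zero ht)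
    exact (hν.restrictScalars (𝕜 := ℝ)).smul analyticAt_const
  · rw [BoundedContinuousFunction.smul_apply, smul_eq_mul]
    rfl

end Coefficient

/-! ### The reduction: Ahlfors–Bers ⟹ `ShearCrossRatioAnalytic` -/

section Reduction

/-- Presentation independence of the modulus of the sheared quad (conformal invariance of the
cross-ratio, `crossRatio_eq_of_image_data` with `h = id`): two uniformizing data of two
presentations of `φ_β R'` have the same Cardy cross-ratio. [folklore] -/
theorem crossRatio_eq_of_shear_presentations {R' : ConformalRectangle} {β : ℂ}
    {R S : ConformalRectangle} (hcR : R.carrier = moduliShear β '' R'.carrier)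
    (hpR : ∀ i, R.pt i = moduliShear β (R'.pt i))
    (hcS : S.carrier = moduliShear β '' R'.carrier) (hpS : ∀ i, S.pt i = moduliShear β (R'.pt i))
    {φ : ConformalEquiv upperHalfPlaneSet R.carrier} {x : Fin 4 → ℝ} (hφ : R.IsUniformizing φ x)
    {ψ : ConformalEquiv upperHalfPlaneSet S.carrier} {y : Fin 4 → ℝ}
    (hψ : S.IsUniformizing ψ y) : crossRatio x = crossRatio y :=
  ConformalRectangle.crossRatio_eq_of_image_data (h := id) differentiableOn_id (injOn_id _)
    continuousOn_id (by rw [image_id, hcS, hcR]) (fun i => by rw [hpS, hpR]; rfl) hφ hψ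

/-- **Ahlfors–Bers ⟹ analyticity of the sheared modulus** (the reduction of the named fact
`ShearCrossRatioAnalytic` to the Ahlfors–Bers theorem). Hypothesis `hAB`: the Ahlfors–Bers
theorem on analytic dependence on parameters in its half-plane form with real parameters ranging
over open subsets of `ℂ` — for a coefficient family `μ t`, `C¹` on `ℍₒ` with `‖μ t‖ ≤ k < 1` and
real-analytic in `t` as a bounded-function-valued map, the normalised (`0, 1, ∞` fixed)
`μ t`-conformal self-homeomorphisms `W t` of the closed upper half-plane (inverses `V t`) exist,
are increasing on `ℝ`, solve the Beltrami equation classically on `ℍₒ` with `W_z ≠ 0`, and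
`t ↦ W t z` is real-analytic for every `z`, `im z ≥ 0` (Ahlfors–Bers, Ann. of Math. 72 (1960):
Thm. 6, Lemma 7 with Thm. 5 (vii), Thm. 11 and its Corollary p. 404). Conclusion: for every
conformal rectangle `R'` the modulus of `φ_α R'` is a real-analytic function `M` of `α ∈ ℍ`.
Proof (the docstring of `ShearCrossRatioAnalytic` made precise): uniformize `R'` by `(f', x')`
(`MarkedDomain.exists_isUniformizing_holds`); the quasiconformal map `φ_α ∘ f'` has the `C¹`
coefficient `μ_α = ν(α) \overline{f′'}/f′'`, `ν(α) = (1 + iα)/(1 - iα)`, `|ν(α)| < 1`, analytic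
in `α` (`exists_analytic_shearCoeff`); near `α₀` apply `hAB` on a ball with the uniform bound
`k = max ‖ν‖ < 1`; `(φ_α ∘ f' ∘ V_α, W_α ∘ x')` uniformizes every presentation of `φ_α R'`
(`exists_isUniformizing_shear`), so the modulus `M α` (cross-ratio of any datum of the canonical
presentation `R'.map (shearHomeomorph α)`, independent of all choices by
`crossRatio_eq_of_isUniformizing_holds`) equals `crossRatio (W_α ∘ x')` near `α₀`, a rational
function of the real-analytic `α ↦ W_α (x'_i)` with non-vanishing denominators.
[cite: AhlforsBers1960, Thm. 11 and Corollary (p. 404)] -/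
theorem shearCrossRatioAnalytic_of_ahlforsBers
    (hAB : ∀ (U : Set ℂ) (μ : ℂ → ℂ → ℂ) (k : ℝ), IsOpen U → k < 1 →
      (∀ t ∈ U, ∀ z ∈ upperHalfPlaneSet, ‖μ t z‖ ≤ k) →
      (∀ t ∈ U, ContDiffOn ℝ 1 (μ t) upperHalfPlaneSet) →
      (∃ μ' : ℂ → (upperHalfPlaneSet →ᵇ ℂ), AnalyticOnNhd ℝ μ' U ∧
        ∀ t ∈ U, ∀ (z : ℂ) (hz : z ∈ upperHalfPlaneSet), μ' t ⟨z, hz⟩ = μ t z) →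
      ∃ W V : ℂ → ℂ → ℂ,
        (∀ z : ℂ, 0 ≤ z.im → AnalyticOnNhd ℝ (fun t => W t z) U) ∧
        ∀ t ∈ U,
          (W t 0 = 0 ∧ W t 1 = 1) ∧
          MapsTo (W t) upperHalfPlaneSet upperHalfPlaneSet ∧
          MapsTo (V t) upperHalfPlaneSet upperHalfPlaneSet ∧
          MapsTo (W t) {z : ℂ | 0 ≤ z.im} {z : ℂ | 0 ≤ z.im} ∧
          MapsTo (V t) {z : ℂ | 0 ≤ z.im} {z : ℂ | 0 ≤ z.im} ∧
          (∀ z : ℂ, 0 ≤ z.im → V t (W t z) = z ∧ W t (V t z) = z) ∧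
          (ContinuousOn (W t) {z : ℂ | 0 ≤ z.im} ∧ ContinuousOn (V t) {z : ℂ | 0 ≤ z.im}) ∧
          (∀ x : ℝ, (W t x).im = 0) ∧
          StrictMono (fun x : ℝ => (W t x).re) ∧
          DifferentiableOn ℝ (W t) upperHalfPlaneSet ∧
          (∀ z ∈ upperHalfPlaneSet,
            fderiv ℝ (W t) z 1 - I * fderiv ℝ (W t) z I ≠ 0 ∧
            fderiv ℝ (W t) z 1 + I * fderiv ℝ (W t) z I =
              μ t z * (fderiv ℝ (W t) z 1 - I * fderiv ℝ (W t) z I))) :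
    ShearCrossRatioAnalytic := by
  intro R'
  obtain ⟨f', x', hux'⟩ := MarkedDomain.exists_isUniformizing_holds R'
  classical
  -- the modulus of the canonical presentation `R'.map (shearHomeomorph α)`
  let M : ℂ → ℝ := fun α => if hα : 0 < α.im then
      crossRatio (MarkedDomain.exists_isUniformizing_holds
        (R'.map (shearHomeomorph α hα.ne'))).choose_spec.choose else 0
  have hMeq : ∀ (α : ℂ) (hα : 0 < α.im) (R : ConformalRectangle)
      (φ : ConformalEquiv upperHalfPlaneSet R.carrier) (x : Fin 4 → ℝ),
      R.carrier = moduliShear α '' R'.carrier → (∀ i, R.pt i = moduliShear α (R'.pt i)) →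
      R.IsUniformizing φ x → crossRatio x = M α := by
    intro α hα R φ x hc hp hux
    have hspec := (MarkedDomain.exists_isUniformizing_holds
        (R'.map (shearHomeomorph α hα.ne'))).choose_spec.choose_spec
    simp only [M, dif_pos hα]
    exact crossRatio_eq_of_shear_presentations hc hp (by simp) (fun i => by simp) hux hspec
  refine ⟨M, fun α₀ hα₀ => ?_, fun α hα R φ x hc hp hux => hMeq α hα R φ x hc hp hux⟩
  -- analyticity at `α₀`: a ball in `ℍ` and the uniform bound on `ν`
  have hα₀' : (0 : ℝ) < α₀.im := hα₀
  set r : ℝ := α₀.im / 2 with hr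
  have hr0 : 0 < r := by positivity
  have him : ∀ α ∈ closedBall α₀ r, 0 < α.im := by
    intro α hα
    rw [mem_closedBall, dist_eq_norm] at hα
    have h1 := abs_im_le_norm (α - α₀)
    rw [sub_im, abs_le] at h1
    linarith [h1.1]
  have hsub : ball α₀ r ⊆ upperHalfPlaneSet := fun t ht => him t (ball_subset_closedBall ht)
  have hνcont : ContinuousOn (fun t : ℂ => ‖(1 + I * t) / (1 - I * t)‖) (closedBall α₀ r) :=
    (ContinuousOn.div (by fun_prop) (by fun_prop)
      fun t ht => one_sub_I_mul_ne_zero (him t ht)).norm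
  obtain ⟨α₁, hα₁, hmax⟩ := (isCompact_closedBall α₀ r).exists_isMaxOn
    (nonempty_closedBall.2 hr0.le) hνcont
  have hk1 : ‖(1 + I * α₁) / (1 - I * α₁)‖ < 1 := norm_shearBeltrami_lt_one (him α₁ hα₁)
  have hkU : ∀ t ∈ ball α₀ r, ‖(1 + I * t) / (1 - I * t)‖ ≤ ‖(1 + I * α₁) / (1 - I * α₁)‖ :=
    fun t ht => isMaxOn_iff.1 hmax t (ball_subset_closedBall ht)
  -- the coefficient family and the Ahlfors–Bers solutions on the ball
  obtain ⟨W, V, han, hW⟩ := hAB (ball α₀ r)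
    (fun t z => (1 + I * t) / (1 - I * t) * (conj (deriv f' z) / deriv f' z))
    ‖(1 + I * α₁) / (1 - I * α₁)‖ isOpen_ball hk1
    (fun t ht z hz => by rw [norm_shearCoeff f' _ hz]; exact hkU t ht)
    (fun t _ => contDiffOn_shearCoeff f' _)
    (by
      obtain ⟨μ', han, hμ'⟩ := exists_analytic_shearCoeff f'
      exact ⟨μ', han.mono hsub, fun t ht z hz => hμ' t (hsub ht) z hz⟩)
  -- data of the sheared rectangles from the normalised solutions
  have hdata : ∀ t ∈ ball α₀ r, ∀ R : ConformalRectangle,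
      R.carrier = moduliShear t '' R'.carrier → (∀ i, R.pt i = moduliShear t (R'.pt i)) →
      ∃ F : ConformalEquiv upperHalfPlaneSet R.carrier,
        R.IsUniformizing F fun i => (W t (x' i)).re := by
    intro t ht R hc hp
    obtain ⟨-, hWmaps, hVmaps, -, -, hinv, ⟨-, hVcont⟩, hreal, hmono, hdiff, hbel⟩ := hW t ht
    exact exists_isUniformizing_shear (hsub ht) hux' hWmaps hVmaps hinv hVcont hreal hmono hdiff
      hbel R hc hp
  -- `M` agrees near `α₀` with the cross-ratio of the real-analytic points `W t (x' i)`
  have hMW : ∀ t ∈ ball α₀ r, M t = crossRatio fun i => (W t (x' i)).re := by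
    intro t ht
    obtain ⟨F, hF⟩ := hdata t ht (R'.map (shearHomeomorph t (hsub ht).ne')) (by simp)
      (fun i => by simp)
    exact (hMeq t (hsub ht) _ F _ (by simp) (fun i => by simp) hF).symm
  have hy : ∀ i, AnalyticAt ℝ (fun t => (W t (x' i)).re) α₀ := fun i =>
    (Complex.reCLM.analyticAt _).comp (han (x' i) (by simp) α₀ (mem_ball_self hr0))
  have hinj : Function.Injective fun i => (W α₀ (x' i)).re := by
    obtain ⟨F, hF⟩ := hdata α₀ (mem_ball_self hr0) (R'.map (shearHomeomorph α₀ hα₀'.ne'))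
      (by simp) (fun i => by simp)
    exact hF.injective
  have hne : ∀ i j : Fin 4, i ≠ j → (W α₀ (x' i)).re - (W α₀ (x' j)).re ≠ 0 := fun i j hij =>
    sub_ne_zero.2 fun h => hij (hinj h)
  have hg : AnalyticAt ℝ (fun t => crossRatio fun i => (W t (x' i)).re) α₀ := by
    simp only [crossRatio]
    exact (((hy 0).sub (hy 1)).mul ((hy 2).sub (hy 3))).div
      (((hy 0).sub (hy 2)).mul ((hy 1).sub (hy 3)))
      (mul_ne_zero (hne 0 2 (by decide)) (hne 1 3 (by decide)))
  refine hg.congr ?_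
  filter_upwards [isOpen_ball.mem_nhds (mem_ball_self hr0)] with t ht
  exact (hMW t ht).symm

end Reduction

end Literature.Probability.RandomPlanarGeometry
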